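import Mathlib
import HarnessLib
import HarnessLib.Audit
import Summits.NavierStokesRegularity.Statement
import Literature.Analysis.FluidPDE.Tao2016AveragedNS.LocalCascadeSolutions
import Literature.Analysis.FluidPDE.Tao2016AveragedNS.RestartedCascadeFlows
import Summits.NavierStokesRegularity.NavierStokesRegularity.Theorems.TaoLadderRungThreeGappedFrontRobustV2
import HarnessLib.Audit.Status.Attr

/-!
Route: TaoLadderRungTwo

# Route TaoLadderRungTwo — Comparable Tao-topology cascades of fixed spread blow up at every small
scale ratio via certified robust front steps (TAO-LADDER rung M_2, lattice level; refutation-first)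

RUNG-LEAF ROUTE (D-0061; leaf = TAO-LADDER rung M_2 AT THE LATTICE LEVEL of cell
harvest/h2-tao-ladder = this route's own `Target` item `RungTwoLatt`; MODEL LATTICE ODEs ONLY —
nothing here is a statement about the Navier–Stokes equations or Clay (A)–(D); the cell PREDICTS the
target FALSE (break point BP-D, sealed P-T1 70 %), so this is the POSITIVE companion of theory-2's
negative package and is filed refutation-first). Target (M_2-latt): for some fixed spread R ≥ 1 and
ALL sufficiently small ε₀ > 0, some symmetric cancelling R-comparable four-mode table on Tao's
topology (max |α| = 1, every non-zero |α| ≥ 1/R) with some one-shell datum has Theorem-4.2-level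
blow-up at scale ratio 1 + ε₀ (no global family obeying Lemma 4.1's conclusions (4.5)–(4.11)). It
suffices to show X = K_A′ ∧ K_B with K_A′ = ComparableGapCertificates (EXISTENTIAL, a UNIFORM FAMILY
of certificates: for one R and every small ε₀ a table in the class and a datum admit GAP DATA
`GapData ε₀ …` — reference set Z ∋ datum, weight w ≥ 1, radius r, tail clause TailFat, exact flows
from the r-ball step one shell up within clock c₀ < c with amplitude ratio ≥ (1+ε₀)^{−θ₀}, θ₀ < θ ≤
1/2, into the shrunken ρr-ball) and K_B = GappedFrontRobust (UNIVERSAL perturbation theorem, the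
SAME item as route TaoLadderRungThree's K_B: every gap datum yields a defect margin η > 0) — because
the deciding theorem `closes` (glue.lean; kernel-checked rc 0 · 0 sorries over the LANDED tree
modules `Literature.Analysis.FluidPDE.Tao2016AveragedNS.LocalCascadeSolutions` (p498221) +
`RestartedCascadeFlows` (p510222), namespace `Literature.Analysis.FluidPDE.TaoCascade`; a port of
the cell's chain `rungTwoLatt_of_gap`, rung2/TaoLadderRung2.lean v5 d4b37cff5cfc6865) turns the
resulting contracting front steps, by Tao's scale covariance (support RestartControl), the restart
bookkeeping (support RestartGlue) and the local-induction-suffices lemma (support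
LocalDynamicsSufficesAt), into the rung claim. Seam: certificate family ∃ / perturbation ∀, no
shared witness. No idea card is realised (cell-internal ladder rung; lens finite, refutation budget
first).
Lean:
`Summit.NavierStokesRegularity.NavierStokesRegularity.Theses.TaoLadderRungTwo.ComparableGapCertificates
∧ Summit.NavierStokesRegularity.NavierStokesRegularity.Theses.TaoLadderRungTwo.GappedFrontRobust`

## Assembly
Pure logic plus positivity arithmetic, PROVED in glue.lean (`closes`, 47 tactic lines,
kernel-checked against the landed modules in work/m2/GlueSelfcheck.lean: rc 0 · 0 errors · 0
sorries; port of the cell's `rungTwoLatt_of_gap` = `contractingFrontStep_of_gap` +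
`rungTwoLatt_of_steps`): from K_A′ take R ≥ 1 and ε_s; for each ε₀ ∈ (0, ε_s] take (i₀, α, X₀, gap
data); K_B gives η, env, (front), (step) for P := ballDesc Z w r; the base clause holds because the
datum lies in Z (`GapData.datum_mem_ball`); `DynamicsLocalAt ε₀ R` follows with Q := epochEnvelope
env: restart the local pseudo-solution at the last checkpoint by RestartControl — the horizon clause
t_N + c(1+ε₀)^(−5N/2)/e_N ≤ T is exactly c ≤ (T − t_N)γ —, apply (step) with L = N − n₀ past epochs
to the restarted (η,η)-pseudo-flow, re-read the StepTo as a level-(N+1) epoch checkpoint by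
RestartGlue; then LocalDynamicsSufficesAt ε₀ R gives a table in the class with NoGlobalCascade ε₀,
which is Target's clause at that ε₀ with the same R and ε_s.

CLOSES_TARGET: closes rung TL-M2 of NavierStokesRegularity: Summit.NavierStokesRegularity.NavierStokesRegularity.Theses.TaoLadderRungTwo.Target (D-0061; not the summit Statement) — the deciding theorem of this route concludes that registered leaf instead of the Statement decl `NavierStokesRegularity` (class rung: servable and labelled, never counted as concluding the summit Statement).

Rationale: WHY THIS LINE. Tao 2016 [Tao2016AveragedNS = arXiv:1402.0290, §§4–6] proves blow-up for ONE table
whose magnitudes are spread over a hierarchy 1 ≪ 1/ε₀ ≪ K ≪ 1/ε that widens as the scale ratio 1 +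
ε₀ → 1; rung M_2 asks whether a FIXED spread R survives the limit ε₀ → 0, i.e. whether the
delay-gate («transition-state») mechanism persists when every coupling acts on the same time scale
and the front must cross ~1/ε₀ shells per energy e-folding. The cell's screens (p2 g3, SCREENS of
model lattices): table T4 = (1, 0.326, 0.134, 0.375, 0.618), R = 7.5, carries a coherent discretely
self-similar front with survival index s > 1 for ε₀ ∈ (≈0.02, 0.19); NUM-T5 (2026-08-27, registered
43c1699c1826374d): at the lower edge the profile PERSISTS and LOSES STABILITY through a complex pair
(|λ_soft| = 0.977 → 0.985 → 0.991 → ≈1.003 at ε₀ = 0.025/0.022/0.020/0.018, Neimark–Sacker-type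
crossing at ε₀* ≈ 0.0185 ± 0.0005) while s crosses 1 at ε₀ ≈ 0.0189 — in the typed dictionary θ =
−ln μ/(2 ln(1+ε₀)) = 0.416/0.452/0.483/0.521, crossing the bookkeeping floor θ = 1/2 at ε₀ ≈ 0.019:
on T4 gap data can exist only for ε₀ ≳ 0.019 and the contraction margin 1 − ρ closes at the edge.
What is imported: as for rung M_3 — the computer-assisted blow-up standard «certified self-similar
profile + linearised stability» of Chen–Hou–Huang [corpus:paper:arxiv-2106.05422, arxiv-2210.07191]
with the profile a fixed point of the one-shift renormalisation (Poincaré) map of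
Dombre–Gilson/Mailybaev [corpus:paper:arxiv-1210.2494 p.9 §5], whose loss of stability as the shell
ratio → 1⁺ is exactly the Hopf scenario computed (non-rigorously, Sabra, m = 1) by
Campolina–Simonnet–Thalabard [corpus:paper:arxiv-2501.07377 p.10 Thm 1, p.22 App. A.b]; and Tao's §6
restart typed once so that certified steps suffice (`rungTwoLatt_of_steps`, kernel-checked). Why
file a predicted-false thesis: K_A′ is the SHARPEST typed form of «the front mechanism survives ε₀ →
0 at fixed spread» — its refutation by a theorem (every fixed-R certificate family has a floor ε_R >
0: the ε₀ → 0 limit of a θ ≤ 1/2 front is a travelling wave of the continuum-scale cascade that the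
scaled action ceiling forbids, theory-2 map §23) is half of the break-point verdict BP-D and either
outcome moves the ladder; no existing route or negatives entry quantifies uniformly in the scale
ratio.

RANKED CRUXES. #0 Target (target) — M_2-latt = `RungTwoLatt` (cell LADDER §13.2): there are R ≥ 1
and ε_s ∈ (0, 1) such that for every ε₀ ∈ (0, ε_s] some table α ∈ InTableClass R (symmetric,
cancelling, R-comparable, Tao-topology shifts) and one-shell datum X₀ satisfy `NoGlobalCascade ε₀ α
X₀` (for all K₁, K₂ ≥ 0 and all large n₀, no family obeys `TaoCascade.CascadeODESolutionFrom ε₀ α K₁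
K₂ n₀ X₀`). Rung leaf; decided by `closes` from the two cruxes and the three supports. PREDICTED
FALSE by the cell (BP-D). (why it might fail: Expected to: at fixed spread the front must cross
~1/ε₀ shells per e-folding and the screens show every comparable table losing coherence at some
ε_*(table) > 0 (T4: 0.0185); the cell's prior for ¬Target is 70 %.) [Tao2016AveragedNS,
arXiv:1402.0290, arXiv:2501.07377]
#2 ComparableGapCertificates (crux) — K_A′ (cell v5 `ComparableGapCertificate R` for some R ≥ 1,
spelled over the tree predicates `TaoCascade.InTableClass` / `TaoCascade.GapData`), the UNIFORM
certificate family: there are R ≥ 1 and ε_s ∈ (0,1) such that for every ε₀ ∈ (0, ε_s] there are an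
observed mode i₀, a table α ∈ InTableClass R, a datum X₀ with X₀ i₀ ≠ 0, and gap data `GapData ε₀ i₀
α X₀ Z w r ρ θ₀ θ c₀ c env₀` — r > 0, 0 ≤ ρ < 1, 0 ≤ θ₀ < θ ≤ 1/2, 0 < c₀ < c, w ≥ 1, datum state ∈
Z, tail clause TailFat ε₀ Z w r (beyond some k₁: 2(1+ε₀)^k w_k ≤ w_{k+1} and 4w_k|z_{i,k}| ≤ r on
Z), (exist₀) defect-free flows from the r-ball around Z exist on the clock window [0, c] at scale
ratio 1 + ε₀, (step₀) each steps within c₀ with ratio ≥ (1+ε₀)^{−θ₀} into the ρr-ball under the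
super-exponential energy envelope env₀. Intended witnesses: per ε₀ an interval-certified fixed point
of the one-shift renormalisation map (a DSS lattice front) with certified contraction, the table
re-optimised along ε₀ inside spread R, plus certified capture of the datum's transient. [difficulty:
XL] (why it might fail: Predicted false: every screened comparable table loses front coherence at
some ε_*(table) > 0 (T4: complex-pair instability at 0.0185, θ > 1/2 below 0.019), and no mechanism
is known that keeps a fixed-spread front contracting as ε₀ → 0 (continuum limit = forbidden
travelling wave).) [Tao2016AveragedNS, arXiv:1402.0290, arXiv:2501.07377, arXiv:1210.2494]
#3 GappedFrontRobust (crux) — K_B (cell v5 `GappedFrontRobust`, spelled over `TaoCascade.GapData` /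
`FrontExists` / `RobustStep`; the SAME ledger item as route TaoLadderRungThree's K_B,
stmt-NavierStokesRegularity-20423), the perturbation theorem for the lattice class, universally
quantified (no shared witness with K_A): for every R, ε₀ > 0, table α ∈ InTableClass R (v5: the
class clause, referee c14 §2(d)), datum (i₀, X₀), reference set Z, weight w, and reals/envelope
forming `GapData ε₀ i₀ α X₀ Z w r ρ θ₀ θ c₀ c env₀` (incl. TailFat), there are a margin η > 0 and an
epoch envelope env such that, with the description P := ballDesc Z w r: (front) from every P-state
with slack 0 ≤ B₀ ≤ η·slackWeight ε₀ θ c env L and compatible energies ½S₀² ≤ F₀ ≤ ½S₀² + B₀ a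
defect-free flow exists on [0, c] (∀ L); (step) every (η, η)-pseudo-flow `PseudoFlowOn τ ε₀ α η η S₀
F₀ B₀ S F` with τ ≥ c from such a start admits `StepTo ε₀ θ c i₀ P (epochEnvelope env) S F τ₁ a` (∀
L). Mechanism: on the shells where η(1+ε₀)^{2k} ≪ 1, Lipschitz control of the lattice vector field
(couplings (1+ε₀)^{5k/2}) in the w-norm on the ball over one clock window and Grönwall — the margins
(1 − ρ)r, θ − θ₀, c − c₀ absorb (η, η)-defects and slack ≤ η·slackWeight; on the shells beyond, the
energy cap ½S² ≤ F ≤ F(0) + transfer ((4.9) has no defect term) together with GapData's tail clause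
TailFat (v5) keeps energy-capped junk and saturated slack inside the super-geometrically thin ball
and under a self-consistent envelope env_k ≍ (r/w_k)²; phantom energy is inert for defect-free flows
((front) follows from (exist₀) with F := ½S² + phantom₀). [difficulty: M] (why it might fail: A
typed-detail door, not the mechanism: the (step) flows carry their OWN a priori constant, so
far-ahead control rests on the energy cap + TailFat; if a PseudoFlowOn field lets phantom become
amplitude faster at the hand-over shells η(1+ε₀)^{2k} ≈ 1, K_B is false as typed (repair: bound
it).) [Tao2016AveragedNS, arXiv:1402.0290]
#9 RestartControl (support) — Tao's scale covariance as bookkeeping (tree vocabulary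
`TaoCascade.PseudoFlowOn` / `restartSlack` / `slackWeight`; shared with TaoLadderRungThree): for θ ≤
1/2, η > 0, c ≥ 0, X₀ i₀ ≠ 0 and K₁, K₂ ≥ 0 there is N₀ such that for n₀ ≥ N₀, along every local
pseudo-solution `CascadeODESolutionOn T ε₀ α K₁ K₂ n₀ X₀ X E` and every run of checkpoints
`ShellCheckpoints ε₀ θ c i₀ n₀ X₀ P (epochEnvelope env) N X E t e` with t_N < T, the restarted
family S_{i,k}(s) = X_{i,N+k}(t_N + s/γ)/e_N, F = E/e_N² (γ = e_N(1+ε₀)^{5N/2}) is a `PseudoFlowOn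
((T − t_N)γ) ε₀ α η η …` from the rescaled checkpoint state with slack `restartSlack`, and 0 ≤
restartSlack ≤ η·slackWeight ε₀ θ c env (N − n₀) — because the defect constants rescale to κ_j = K_j
e_N^{−1}(1+ε₀)^{−N/2} ≤ (K_j/|X₀ i₀|)(1+ε₀)^{−n₀/2} and the accumulated (4.10)-slack splits over
past epochs under the epoch envelope. [difficulty: M] [Tao2016AveragedNS, arXiv:1402.0290]
#9 RestartGlue (support) — Definitional bookkeeping (tree `TaoCascade.StepTo` / `EpochCheckpoints`;
shared with TaoLadderRungThree): a `StepTo` of the flow restarted at checkpoint (N, t_N, e_N) is a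
level-(N+1) `ShellCheckpoints` of the original family with t_{N+1} = t_N + τ₁/γ and e_{N+1} = a·e_N
(Function.update on the two bookkeeping sequences; the epoch clause by the affine substitution s' =
(s − t_N)γ). [difficulty: provable-now] [Tao2016AveragedNS, arXiv:1402.0290]
#9 LocalDynamicsSufficesAt (support) — The local robust checkpoint induction implies the blow-up
claim at one scale ratio (tree `TaoCascade.DynamicsLocalAt` / `NoGlobalCascade`; shared with
TaoLadderRungThree): for ε₀ > 0 and R ≥ 1, `DynamicsLocalAt ε₀ R` ⇒ ∃ α ∈ InTableClass R, X₀ with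
`NoGlobalCascade ε₀ α X₀` — restrict a global pseudo-solution to [0, T_* + 1] with T_* = (c/|X₀
i₀|)(1+ε₀)^{−5n₀/2} Σ_k (1+ε₀)^{(θ−5/2)k} the uniform lifespan sum
(`CascadeODESolutionFrom.restrictOn`), run the ℤ-induction from the base (the horizon clause t_N +
c(1+ε₀)^{−5N/2}/e_N ≤ T_* + 1 holds at every level by the clock and ratio fields), and contradict
the a priori bound (4.5) at time T_* + 1 by amplitudes e_N ≥ (1+ε₀)^{−θ(N−n₀)}|X₀ i₀|
(`checkpointContradiction`). [difficulty: M] [Tao2016AveragedNS, arXiv:1402.0290]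

TWO-LAYER PLAN. Foreseen glued splits (nothing filed now): ComparableGapCertificates ⇐
ContinuumFront → UniformLatticeCorrection → ComparableGapCertificates, where ContinuumFront (the ε₀
→ 0 limit object: a travelling-wave profile of the continuum-scale cascade obtained from the lattice
by x = k·ln(1+ε₀), with amplitude-ratio exponent θ_∞ < 1/2 and a spectral gap of its linearisation
transverse to the scaling symmetry, for some table of spread R) and UniformLatticeCorrection (for ε₀
≤ ε_s the one-shift lattice map is a C¹-small perturbation of the time-ln(1+ε₀) map of the continuum
flow in the weighted norm, so the gap persists with ρ = 1 − κε₀, θ₀ = θ_∞ + O(ε₀), TailFat from the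
double-exponential decay ahead) — glue M-sized. This split is ALSO the refutation plan:
¬ContinuumFront for every comparable table (scaled action ceiling) is the expected theorem.
GappedFrontRobust ⇐ DefectGronwall → EnergyCapTail → GappedFrontRobust exactly as in route
TaoLadderRungThree (shared item, shared children).

KILL CRITERIA. refuted:ComparableGapCertificates with a SUBSTANTIVE witness — a theorem that for
every R ≥ 1 there are arbitrarily small ε₀ at which no table in InTableClass R admits gap data
(engines: theory-2's scaled action ceiling / B′ evaluated along ε₀ → 0, i.e. non-existence of a θ ≤
1/2 continuum front; or a certified computation placing the instability edge ε_*(table) > 0 for an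
exhaustive finite family of tables, which alone is NOT a theorem over the class) — closes the route
`refuted:ComparableGapCertificates`; this is the EXPECTED outcome (cell prior 70 %) and is ladder
news as the front-mechanism half of BP-D (¬Target itself needs theory-2's negative route: other
mechanisms than fronts must be excluded). A MISSTATED-class refutation (TailFat growth rate, θ ≤ 1/2
floor vs a table whose ratio needs θ slightly above at moderate ε₀, `slackWeight`, the (1+ε₀)^{10k}
weight in `PseudoFlowOn`) is repaired by restating the clause with K_A′'s witnesses obeying it.
refuted:GappedFrontRobust SUBSTANTIVELY kills every certificate-based rung route (M₂♭, M_2, M_3) at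
once — see TaoLadderRungThree. Mooted if RungTwoLatt is proved or refuted by any other route
(theory-2's TaoLadderRungTwoBreak proving ¬Target closes the leaf negatively and this route is
`superseded`).

NOT DECOMPOSED YET. Deliberately NOT items at open: the choice of the table family along ε₀ (fixed
T4 vs re-optimised within spread R vs larger R), the values of (Z, w, r, ρ, θ₀, c₀, c, env₀, k₁) per
ε₀, the continuum-limit object (Two-layer plan) and its spectral problem, local well-posedness of
the exact lattice in the weighted space (part of (front)), the certificate format, the proofs of the
three supports (shared with TaoLadderRungThree; h14/p1). The per-ε₀ certificate at ONE ε₀ (M₂♭,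
NUM-4 at T4, ε₀ = 0.1) is the BC5 rung, not an item.

CHEAPEST FALSIFIER. NUM-T5 continued (p2, registered, < 2 core-h): the front-pinned reduced Newton
solver below ε₀ = 0.018 on T4 and the same instability scan on the two best larger-spread tables (R
= 16, 64 argmax of the λ → 1⁺ screens): if every screened table shows |λ_soft| crossing 1 at some
ε_*(table) > 0 with θ > 1/2 below it, K_A′ is screen-dead for R ≤ 64 (a SCREEN, not a theorem — the
typed refutation is the continuum-front non-existence); if instead some table family keeps |λ_soft|
< 1 and θ < 1/2 down to the solver's floor, the cell's BP-D prior must move. Already run: NUM-T5 at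
T4 down to 0.018 (instability edge found, INBOX 2026-08-27T06:25:47Z).

NUMBERS. T4 = (1, 0.326, 0.134, 0.375, 0.618), R = 7.5 (p2 g3 screens): coherent DSS front with s >
1 on ε₀ ∈ (≈0.02, 0.19); NUM-T5: ε₀ = 0.025/0.022/0.020/0.018 → μ = 0.97965/0.98051/0.98105/0.98157,
s = 1.00415/1.00208/1.00067/0.99924, growth per map 0.9748/0.9844/0.9911/1.0028, soft mode complex
(arg ≈ 100°), Neimark–Sacker crossing ε₀* ≈ 0.0185 ± 0.0005, s = 1 at ≈ 0.0189; typed dictionary θ =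
−ln μ/(2 ln(1+ε₀)) = 0.4162/0.4523/0.4830/0.5212, θ = 1/2 at ε₀ ≈ 0.019 (the restart bookkeeping
needs θ ≤ 1/2: κ_j ∝ e_N^{−1}(1+ε₀)^{−N/2}). Upper edge ε₀ = 0.2: s = 0.995, ρ = 0.72 (fold-free
there too). Tao's table: spread ~ K/ε → ∞, not in any InTableClass R.

DEFINITION REQUESTS. None outstanding: the lattice vocabulary has LANDED —
`Literature.Analysis.FluidPDE.Tao2016AveragedNS.LocalCascadeSolutions` (p498221:
CascadeODESolutionOn, ShellCheckpoints, datumState/Energy, InTableClass, NoGlobalCascade,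
checkpointContradiction_holds) and `…RestartedCascadeFlows` (definition item defn-PseudoFlowOn,
p510222, 367 l., sha16 2f2f73c588aeef0b: EpochCheckpoints, DynamicsLocalAt, epochEnvelope,
PseudoFlowOn, StepTo, slackWeight, restartX/E/Slack, FrontExists, RobustStep, FrontStepAt, ballDesc,
TailFat, GapData). The items are spelled IN FULL over `Literature.Analysis.FluidPDE.TaoCascade.*`;
the closed cell statements are this route's items, not Literature (rule 4b). Cite facts wanted: none
new. Operator ask standing: MINT TL-M2 :=
`Summit.NavierStokesRegularity.NavierStokesRegularity.Theses.TaoLadderRungTwo.Target` as an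
admissible rung closer (HOME/OPS-REQUESTS.md), then `route edit --closes-target`; until then the
route is draft with `glue.conclusion-mismatch` only.

Novelty: Searches (2026-08-27, both corpora; run by theory-1 g5 for this package, inherited by g6 and not
re-run): `lit search "Mailybaev renormalization universality blowup shell model"` (HELD
arxiv-1210.2494; arxiv-2501.07377; arXiv:1201.1631; arxiv-2408.04659); `lit vsearch "self-similar
blow-up profile of a shell model as a fixed point of the renormalization map, loss of stability as
the shell spacing tends to one"` (book hits only: ditlevsen2010 pp. 6, 28, 49); `lit search "dyadic
model Euler finite time blow-up Katz Pavlović"` (arxiv-math_0601074,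
doi:10.1090/s0002-9947-04-03532-9, doi:10.1007/s00220-015-2295-y, arxiv-1705.01456); `lit search
"Chen Hou computer-assisted blowup self-similar" --source local` (arxiv-2106.05422, 2210.07191,
2308.01528 …); `lit galaxy search "blowup in shell model|Mailybaev|Dombre and Gilson" --star all`
(24 rows, noise); `lit galaxy search "shell model|computer-assisted proof|self-similar blowup"
--star pdf` (10, noise) — no hits for a blow-up statement UNIFORM IN THE SHELL RATIO → 1⁺ for any
shell/lattice cascade, rigorous or not, beyond the Sabra Hopf computation of arxiv-2501.07377, in
corpus(fts+vec) and galaxy.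
Nearest prior art found: [corpus:paper:arxiv-2501.07377 p.10 Thm 1, p.22 App. A.b]
Campolina–Simonnet–Thalabard 2025 — the Sabra similarity fixed point loses stability through a Hopf
bifurcation, with the λ → 1⁺ asymptotics W_Hopf ~ 1/(4ε) (numerical, m = 1, not Tao topology);
[corpus:paper:arxiv-1210.2494 p.9 §5] Mailybaev 2013 — the Po  [refs: 10.1090/s0002-9947-04-03532-9, 10.1007/s00220-015-2295-y, 1201.1631, arxiv-1210.2494, arxiv-2501.07377, arxiv-2408.04659, arxiv-math_0601074, doi:10.1090/s0002-9947-04-03532-9, doi:10.1007/s00220-015-2295-y, arxiv-1705.01456, arxiv-2106.05422, paper:arxiv-2501.07377, paper:arxiv-1210.2494, paper:arxiv-2106.05422]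

Barriers (technique_class: cascade-blowup, certified-RG-fixed-point, restart): - technique_class: cascade-blowup, certified-RG-fixed-point, restart
- Literature.Barriers.NavierStokesRegularity.TaoAveragedBlowup: consistent, and outside its step
test — Tao's averaged blow-up (and its abstract two-step corollary `abstractTwoStepFails`, file
AveragedEquationStepTest.lean): the step test constrains arguments that would prove REGULARITY of
true NS by steps blind to the averaging (Tao's barrier); this route proves BLOW-UP for a model
lattice and claims nothing about NS; the crux quantifies over lattice families, not over NS
solutions.
- Literature.Barriers.NavierStokesRegularity.AveragedTypeIBlowup: outside — that file concerns
Type-I rates inside Tao's full averaged class (dilations, hierarchical table); the classes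
InTableClass R at small ε₀ are disjoint from Tao's table (spread K/ε ≫ R) and the crux is rate-free
(θ ≤ 1/2 is an amplitude-ratio floor per shell, not a Type-I bound).
- Literature.Barriers.NavierStokesRegularity.DyadicCascadeRegularity: INSIDE the comparable class
but CONSISTENT (re-worded per cell referee c17) — Barbato–Morandin–Romito 2011 Thm 1 concerns the
scalar dyadic chain = the dyadic MEMBER `dyadicTable` ∈ E₂(R ≥ 2) at scale ratio ε₀ = 1 (base 2),
non-negative data, WITH dissipation of 3-D strength (globally regular); evasion = this route's items
are INVISCID lattice statements (Tao's cascade class has no viscosity; the viscous step is Tao's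
separate §4 reduction) about vector tables, at ε₀ → 0 (base 1+ε₀ ↓ 1, not base 2); the printed

History (route lifecycle, newest last):
- 2026-08-27T12:25:17Z · closes_target -> closes rung TL-M2 of NavierStokesRegularity: Summit.NavierStokesRegularity.NavierStokesRegularity.Theses.TaoLadderRungTwo.Target (D-0061; not the summit Statement) (planner-harvest-h2-tao-ladder-theory-1-g8-0)

sub-problem: NavierStokesRegularity · status: open · opened planner-harvest-h2-tao-ladder-theory-1-g6-0 2026-08-27T08:35:24Z · rev 7 · ledger route-NavierStokesRegularity-TaoLadderRungTwo
GENERATED by the gate from the ledger (D-0016/17). Provers cite these decls: `theorem foo : Summit.NavierStokesRegularity.NavierStokesRegularity.Theses.TaoLadderRungTwo.<Decl> := …` in Summits/NavierStokesRegularity/NavierStokesRegularity/Theorems/<Name>.lean.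
-/

namespace Summit.NavierStokesRegularity.NavierStokesRegularity.Theses.TaoLadderRungTwo

open scoped BigOperators Topology Manifold Classical MeasureTheory ProbabilityTheory Matrix InnerProductSpace ComplexConjugate ContinuousMap
open Filter Set Function TopologicalSpace MeasureTheory

attribute [summit_statement] _root_.NavierStokesRegularity
-- H21.Audit: the closer leaf Summit.NavierStokesRegularity.NavierStokesRegularity.Theses.TaoLadderRungTwo.Target is an item decl of this route file — tagged summit_statement below, after its declaration

open Literature.NS

/-- item stmt-NavierStokesRegularity-22645 · crux · rank 2 · open · by planner
why it might fail: Uniform-in-ε₀ comparability is exactly what Tao’s construction lacks (his tables degenerate like ε₀^{-O(1)} — that is RungTwoPoly’s K_A); the contraction slack σ(ε₀) or the tame-behind constants may degenerate as ε₀ → 0 even if every fixed ε₀ admits a certificate.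
sources: Tao2016AveragedNS, arXiv:1402.0290, cell:LADDER.md §23.3/§25.7, cell:rung1/RUNG1-P2G5-REPORT.md §20 (T4 @ 1/10 row; VALIDATED interval, unaudited — referee c36 R15)
[crux] K_A v2 for the COMPARABLE class (MODEL lattice only; nothing about Navier–Stokes): one spread
R ≥ 1 and a threshold εs ∈ (0,1) such that for EVERY scale ratio 0 < ε₀ ≤ εs some R-comparable
symmetric cancelling table α and datum X₀ (X₀ i₀ ≠ 0) admit format-v2 gap data `GapData₂ σ ε₀ i₀ α
X₀ Z w r ρ θ₀ θ c₀ c env₀` AND the thin-tail clause (inline spelling of `TaoCascade.TailThin ε₀ w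
r`, p565233: ∀ ϑ > 0, eventually (1+ε₀)^{5(k+2)/2}·r·w(k+1) ≤ ϑ·w(k)²) (T1 conjunct; hypothesis of
K_B₂ in the same edit). Intended witnesses: a one-parameter family of mirror/T♭-type tables whose
epoch-map fixed point persists with UNIFORM comparability as ε₀ ↓ 0, Gaussian weights ahead of the
front (T2). Replaces v1 `ComparableGapCertificates` (stmt-…-20500, v1 format, retriaged aside). -/
@[route_item "route-NavierStokesRegularity-TaoLadderRungTwo", crux]
def ComparableGapCertificatesV2 : Prop :=
  ∃ R : ℝ, 1 ≤ R ∧ ∃ εs : ℝ, 0 < εs ∧ εs < 1 ∧ ∀ ε₀ : ℝ, 0 < ε₀ → ε₀ ≤ εs → ∃ (σ : ℝ) (i₀ : Fin 4) (α : Fin 4 → Fin 4 → Fin 4 → ℤ × ℤ × ℤ → ℝ) (X₀ : Fin 4 → ℝ) (Z : Set (Fin 4 → ℤ → ℝ)) (w : ℤ → ℝ) (r ρ θ₀ θ c₀ c : ℝ) (env₀ : ℤ → ℝ), Literature.Analysis.FluidPDE.TaoCascade.InTableClass R α ∧ X₀ i₀ ≠ 0 ∧ Literature.Analysis.FluidPDE.TaoCascade.GapData₂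 σ ε₀ i₀ α X₀ Z w r ρ θ₀ θ c₀ c env₀ ∧ (∀ ϑ : ℝ, 0 < ϑ → ∃ k₂ : ℤ, ∀ k : ℤ, k₂ ≤ k → (1 + ε₀) ^ ((5 : ℝ) * (k + 2) / 2) * r * w (k + 1) ≤ ϑ * w k ^ 2)

/-- item stmt-NavierStokesRegularity-22114 · crux · rank 3 · closed · proved by Summit.NavierStokesRegularity.NavierStokesRegularity.Cruxes.GappedFrontRobustV2.ThreeZone.GappedFrontRobustV2_of (prover) · by planner
why it might fail: A further format hinge beyond H1–H4b′: the active-window comparison may need a modulus (Lipschitz constant of the exact flow on the ball, or a uniform active-window length) that GapData₂ does not record, or TameBehind may be too weak to bound the low shells’ forcing over one clock window.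
sources: Tao2016AveragedNS, arXiv:1402.0290, cell:rung2/kb-p1g9/KB2-ARCHITECTURE-p1g9.md, cell:LADDER.md §25.7, cell:referee/PASS-FAIL.md Cycle 33/35 (T1–T3)
[crux] K_B v2 — CERTIFICATE FORMAT v2 (MODEL lattice only; nothing about Navier–Stokes). For every
R-comparable symmetric cancelling four-mode table α at scale ratio 1+ε₀ > 0: format-v2 gap data
`GapData₂ σ ε₀ i₀ α X₀ Z w r ρ θ₀ θ c₀ c env₀` (v1 `GapData` + σ-contraction slack `StepSlack` +
tame shells behind `TameBehind` + tail compatibility `TailCompat`, tree: RestartedCascadeFlows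
ll.375–460) together with the thin-tail clause (inline spelling of `TaoCascade.TailThin ε₀ w r`,
p565233: ∀ ϑ > 0, eventually (1+ε₀)^{5(k+2)/2}·r·w(k+1) ≤ ϑ·w(k)²) (hinge H4b′) yields a margin η >
0 and an epoch envelope env with `FrontExists` AND `RobustStep` for the ball description `ballDesc Z
w r` (ONE item, shared η/env witnesses — referee c33: no FrontExists/RobustStep split). Replaces v1
`GappedFrontRobust` (stmt-NavierStokesRegularity-20423: UNPROVABLE-AS-TYPED at hinges H1–H4/H4b′,
HELD, retriaged aside). Proof architecture (p1 g9, HOME rung2/kb-p1g9/KB2-ARCHITECTURE-p1g9.md):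
three zones — tail induction (landed helpers
Theorems/TaoLadderRungThreeGappedFrontRobust{TailEnergy,TailStep,Comparison,StepTransfer}.lean,
p562595/p563528/p564063/p564486/p565789), active-window Grönwall comparison on -/
@[route_item "route-NavierStokesRegularity-TaoLadderRungTwo", crux]
def GappedFrontRobustV2 : Prop :=
  ∀ (R σ ε₀ : ℝ) (i₀ : Fin 4) (α : Fin 4 → Fin 4 → Fin 4 → ℤ × ℤ × ℤ → ℝ) (X₀ : Fin 4 → ℝ) (Z : Set (Fin 4 → ℤ → ℝ)) (w : ℤ → ℝ) (r ρ θ₀ θ c₀ c : ℝ) (env₀ : ℤ → ℝ), Literature.Analysis.FluidPDE.TaoCascade.InTableClass R α → 0 < ε₀ → Literature.Analysis.FluidPDE.TaoCascade.GapData₂ σ ε₀ i₀ α X₀ Z w r ρ θ₀ θ c₀ c env₀ → (∀ ϑ : ℝ, 0 < ϑ → ∃ k₂ : ℤ, ∀ k : ℤ, k₂ ≤ k → (1 + ε₀) ^ ((5 : ℝ) * (k + 2) / 2) * r * w (k + 1) ≤ ϑ * w k ^ 2) → ∃ (η : ℝ) (env : ℤ → ℝ), 0 < η ∧ Literature.Analysis.FluidPDE.TaoCascade.FrontExists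 ε₀ θ c η α (Literature.Analysis.FluidPDE.TaoCascade.ballDesc Z w r) env ∧ Literature.Analysis.FluidPDE.TaoCascade.RobustStep ε₀ θ c η i₀ α (Literature.Analysis.FluidPDE.TaoCascade.ballDesc Z w r) env

/-- `GappedFrontRobustV2` holds: proved by `Summit.NavierStokesRegularity.NavierStokesRegularity.Cruxes.GappedFrontRobustV2.ThreeZone.GappedFrontRobustV2_of`. -/
theorem GappedFrontRobustV2_holds : GappedFrontRobustV2 := _root_.Summit.NavierStokesRegularity.NavierStokesRegularity.Cruxes.GappedFrontRobustV2.ThreeZone.GappedFrontRobustV2_of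

/-- item stmt-NavierStokesRegularity-20499 · aside · rank 0 · open · by planner
why it might fail: Expected to: at fixed spread the front must cross ~1/ε₀ shells per e-folding and the screens show every comparable table losing coherence at some ε_*(table) > 0 (T4: 0.0185); the cell's prior for ¬Target is 70 %.
sources: Tao2016AveragedNS, arXiv:1402.0290, arXiv:2501.07377
[target] M_2-latt = `RungTwoLatt` (cell LADDER §13.2): there are R ≥ 1 and ε_s ∈ (0, 1) such that
for every ε₀ ∈ (0, ε_s] some table α ∈ InTableClass R (symmetric, cancelling, R-comparable,
Tao-topology shifts) and one-shell datum X₀ satisfy `NoGlobalCascade ε₀ α X₀` (for all K₁, K₂ ≥ 0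
and all large n₀, no family obeys `TaoCascade.CascadeODESolutionFrom ε₀ α K₁ K₂ n₀ X₀`). Rung leaf;
decided by `closes` from the two cruxes and the three supports. PREDICTED FALSE by the cell (BP-D). -/
@[route_item "route-NavierStokesRegularity-TaoLadderRungTwo"]
def Target : Prop :=
  ∃ R : ℝ, 1 ≤ R ∧ ∃ εs : ℝ, 0 < εs ∧ εs < 1 ∧ ∀ ε₀ : ℝ, 0 < ε₀ → ε₀ ≤ εs → ∃ (α : Fin 4 → Fin 4 → Fin 4 → ℤ × ℤ × ℤ → ℝ) (X₀ : Fin 4 → ℝ), Literature.Analysis.FluidPDE.TaoCascade.InTableClass R α ∧ Literature.Analysis.FluidPDE.TaoCascade.NoGlobalCascade ε₀ α X₀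

/-- item stmt-NavierStokesRegularity-20500 · aside · rank 2 · open · by planner
why it might fail: Predicted false: every screened comparable table loses front coherence at some ε_*(table) > 0 (T4: complex-pair instability at 0.0185, θ > 1/2 below 0.019), and no mechanism is known that keeps a fixed-spread front contracting as ε₀ → 0 (continuum limit = forbidden travelling wave).
sources: Tao2016AveragedNS, arXiv:1402.0290, arXiv:2501.07377, arXiv:1210.2494
[crux] K_A′ (cell v5 `ComparableGapCertificate R` for some R ≥ 1, spelled over the tree predicates
`TaoCascade.InTableClass` / `TaoCascade.GapData`), the UNIFORM certificate family: there are R ≥ 1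
and ε_s ∈ (0,1) such that for every ε₀ ∈ (0, ε_s] there are an observed mode i₀, a table α ∈
InTableClass R, a datum X₀ with X₀ i₀ ≠ 0, and gap data `GapData ε₀ i₀ α X₀ Z w r ρ θ₀ θ c₀ c env₀`
— r > 0, 0 ≤ ρ < 1, 0 ≤ θ₀ < θ ≤ 1/2, 0 < c₀ < c, w ≥ 1, datum state ∈ Z, tail clause TailFat ε₀ Z w
r (beyond some k₁: 2(1+ε₀)^k w_k ≤ w_{k+1} and 4w_k|z_{i,k}| ≤ r on Z), (exist₀) defect-free flows
from the r-ball around Z exist on the clock window [0, c] at scale ratio 1 + ε₀, (step₀) each steps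
within c₀ with ratio ≥ (1+ε₀)^{−θ₀} into the ρr-ball under the super-exponential energy envelope
env₀. Intended witnesses: per ε₀ an interval-certified fixed point of the one-shift renormalisation
map (a DSS lattice front) with certified contraction, the table re-optimised along ε₀ inside spread
R, plus certified capture of the datum's transient. [difficulty: XL] -/
@[route_item "route-NavierStokesRegularity-TaoLadderRungTwo"]
def ComparableGapCertificates : Prop :=
  ∃ R : ℝ, 1 ≤ R ∧ ∃ εs : ℝ, 0 < εs ∧ εs < 1 ∧ ∀ ε₀ : ℝ, 0 < ε₀ → ε₀ ≤ εs → ∃ (i₀ : Fin 4) (α : Fin 4 → Fin 4 → Fin 4 → ℤ × ℤ × ℤ → ℝ) (X₀ : Fin 4 → ℝ) (Z : Set (Fin 4 → ℤ → ℝ)) (w : ℤ → ℝ) (r ρ θ₀ θ c₀ c : ℝ) (env₀ : ℤ → ℝ), Literature.Analysis.FluidPDE.TaoCascade.InTableClass R α ∧ X₀ i₀ ≠ 0 ∧ Literature.Analysis.FluidPDE.TaoCascade.GapData ε₀ i₀ α X₀ Z w r ρ θ₀ θ c₀ c env₀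

/-- item stmt-NavierStokesRegularity-20423 · aside · rank 3 · open · by planner
why it might fail: UNPROVABLE AS TYPED (held 2026-08-27): GapData leaves the certificate format open at four hinges — H1 reference growth behind, H2 drain (typer T3), H3 amplitude slack in step₀, H4 two-sided tail — so RobustStep fails on pathological gap data; repair: format v2 GapData₂ → new item GappedFrontRobust₂.
sources: Tao2016AveragedNS, arXiv:1402.0290
[crux] K_B (cell v5 `GappedFrontRobust`, spelled with the requested module's packaging predicates
`FrontExists` / `RobustStep`), the perturbation theorem for the lattice class, universally
quantified (no shared witness with K_A): for every R, ε₀ > 0, table α ∈ InTableClass R, datum (i₀,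
X₀), reference set Z, weight w, and reals/envelope forming `GapData ε₀ i₀ α X₀ Z w r ρ θ₀ θ c₀ c
env₀` (incl. TailFat), there are a margin η > 0 and an epoch envelope env such that, with the
description P := ballDesc Z w r: (front) `FrontExists ε₀ θ c η α P env` — from every P-state with
slack 0 ≤ B₀ ≤ η·slackWeight ε₀ θ c env L and compatible energies ½S₀² ≤ F₀ ≤ ½S₀² + B₀ a
defect-free flow `PseudoFlowOn c ε₀ α 0 0 S₀ F₀ B₀ S F` exists on [0, c] (∀ L); (step) `RobustStep
ε₀ θ c η i₀ α P env` — every (η, η)-pseudo-flow `PseudoFlowOn τ ε₀ α η η S₀ F₀ B₀ S F` with τ ≥ c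
from such a start admits `StepTo ε₀ θ c i₀ P (epochEnvelope env) S F τ₁ a` (∀ L). Mechanism: on the
shells where η(1+ε₀)^(2k) ≪ 1, Lipschitz control of the lattice vector field (couplings
(1+ε₀)^(5k/2)) in the w-norm on the ball over one clock window and Grönwall — the margins (1 − ρ)r,
θ − θ₀, c − c₀ absorb (η, η)-defects and slack ≤ -/
@[route_item "route-NavierStokesRegularity-TaoLadderRungTwo"]
def GappedFrontRobust : Prop :=
  ∀ (R ε₀ : ℝ) (i₀ : Fin 4) (α : Fin 4 → Fin 4 → Fin 4 → ℤ × ℤ × ℤ → ℝ) (X₀ : Fin 4 → ℝ) (Z : Set (Fin 4 → ℤ → ℝ)) (w : ℤ → ℝ) (r ρ θ₀ θ c₀ c : ℝ) (env₀ : ℤ → ℝ), Literature.Analysis.FluidPDE.TaoCascade.InTableClass R α → 0 < ε₀ → Literature.Analysis.FluidPDE.TaoCascade.GapData ε₀ i₀ α X₀ Z w r ρ θ₀ θ c₀ c env₀ → ∃ (η : ℝ) (env : ℤ → ℝ), 0 < η ∧ Literature.Analysis.FluidPDE.TaoCascade.FrontExists ε₀ θ c η α (Literature.Analysis.FluidPDE.TaoCascade.ballDesc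 Z w r) env ∧ Literature.Analysis.FluidPDE.TaoCascade.RobustStep ε₀ θ c η i₀ α (Literature.Analysis.FluidPDE.TaoCascade.ballDesc Z w r) env

/-- item stmt-NavierStokesRegularity-20424 · support · rank 9 · closed · proved by Summit.NavierStokesRegularity.NavierStokesRegularity.Theorems.taoLadderRungTwo_restartControl_proof (prover) · by planner
sources: Tao2016AveragedNS, arXiv:1402.0290
[support] Tao's scale covariance as bookkeeping (cell v5 `RestartControl`, over
`TaoCascade.EpochCheckpoints` / `PseudoFlowOn` / `restartX` / `restartE` / `restartSlack` /
`slackWeight`): for θ ≤ 1/2, η > 0, c ≥ 0, X₀ i₀ ≠ 0 and K₁, K₂ ≥ 0 there is N₀ such that for n₀ ≥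
N₀, along every local pseudo-solution `CascadeODESolutionOn T ε₀ α K₁ K₂ n₀ X₀ X E` and every run of
epoch checkpoints `EpochCheckpoints ε₀ θ c i₀ n₀ X₀ P (epochEnvelope env) N X E t e` with t_N < T,
the restarted family S_(i,k)(s) = X_(i,N+k)(t_N + s/γ)/e_N, F = E/e_N² (γ = e_N(1+ε₀)^(5N/2)) is a
`PseudoFlowOn ((T − t_N)γ) ε₀ α η η …` from the rescaled checkpoint state with slack `restartSlack`,
and 0 ≤ restartSlack ≤ η·slackWeight ε₀ θ c env (N − n₀) — because the defect constants rescale to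
κ_j = K_j e_N^(−1)(1+ε₀)^(−N/2) ≤ (K_j/|X₀ i₀|)(1+ε₀)^(−n₀/2) for θ ≤ 1/2 (checked by hand this seat
against the tree's `CascadeODESolutionOn` fields: quadTerm, (4.8), (4.9), (4.10) are covariant under
the restart with exactly these constants) and the accumulated (4.10)-slack splits over past epochs
under the epoch envelope (e_(j−1) ≤ (1+ε₀)^(θ(N−j+1)) e_N, epoch length ≤
c(1+ε₀)^(−5(j−1)/2)/e_(j−1)); chain rule for derivWithi -/
@[route_item "route-NavierStokesRegularity-TaoLadderRungTwo", crux]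
def RestartControl : Prop :=
  ∀ (ε₀ θ c η : ℝ) (i₀ : Fin 4) (α : Fin 4 → Fin 4 → Fin 4 → ℤ × ℤ × ℤ → ℝ) (X₀ : Fin 4 → ℝ) (P : (Fin 4 → ℤ → ℝ) → (Fin 4 → ℤ → ℝ) → Prop) (env : ℤ → ℝ) (K₁ K₂ : ℝ), 0 < ε₀ → θ ≤ 1 / 2 → 0 ≤ c → 0 < η → X₀ i₀ ≠ 0 → 0 ≤ K₁ → 0 ≤ K₂ → ∃ N₀ : ℤ, ∀ n₀ : ℤ, N₀ ≤ n₀ → ∀ T : ℝ, 0 < T → ∀ X E : Fin 4 → ℤ → ℝ → ℝ, Literature.Analysis.FluidPDE.TaoCascade.CascadeODESolutionOn T ε₀ α K₁ K₂ n₀ X₀ X E → ∀ N : ℤ, n₀ ≤ N → ∀ t e : ℤ → ℝ, Literature.Analysis.FluidPDE.TaoCascade.EpochCheckpoints ε₀ θ c i₀ n₀ X₀ P (Literature.Analysis.FluidPDE.TaoCascade.epochEnvelope env) N X E t e → t N < T → Literature.Analysis.FluidPDE.TaoCascade.PseudoFlowOn ((T - t N) * (e N * (1 + ε₀) ^ ((5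 : ℝ) * N / 2))) ε₀ α η η (fun i k => X i (N + k) (t N) / e N) (fun i k => E i (N + k) (t N) / e N ^ 2) (Literature.Analysis.FluidPDE.TaoCascade.restartSlack ε₀ K₂ N (t N) (e N) E) (Literature.Analysis.FluidPDE.TaoCascade.restartX ε₀ N (t N) (e N) X) (Literature.Analysis.FluidPDE.TaoCascade.restartE ε₀ N (t N) (e N) E) ∧ ∀ i k, 0 ≤ Literature.Analysis.FluidPDE.TaoCascade.restartSlack ε₀ K₂ N (t N) (e N) E i k ∧ Literature.Analysis.FluidPDE.TaoCascade.restartSlack ε₀ K₂ N (t N) (e N) E i k ≤ η * Literature.Analysis.FluidPDE.TaoCascade.slackWeight ε₀ θ c env (N - n₀).toNat k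

-- `RestartControl` holds: proved by `Summit.NavierStokesRegularity.NavierStokesRegularity.Theorems.taoLadderRungTwo_restartControl_proof` (its module imports this route file, so no `_holds` link can be stated here).

/-- item stmt-NavierStokesRegularity-20425 · support · rank 9 · closed · proved by Summit.NavierStokesRegularity.NavierStokesRegularity.Theorems.taoLadderRungTwo_restartGlue_proof (prover) · by planner
sources: Tao2016AveragedNS, arXiv:1402.0290
[support] Definitional bookkeeping (cell v5 `RestartGlue`, over `TaoCascade.EpochCheckpoints` /
`StepTo`): a `StepTo` of the flow restarted at checkpoint (N, t_N, e_N) is a level-(N+1)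
`EpochCheckpoints` of the original family with t_(N+1) = t_N + τ₁/γ and e_(N+1) = a·e_N
(Function.update on the two bookkeeping sequences leaves levels ≤ N untouched; amp from a ≤
|S_(i₀,1)(τ₁)|; state by funext + `N + (1 + k) = N + 1 + k`; the epoch clause by the affine
substitution s' = (s − t_N)γ; life from τ₁ ≤ c; ratio from (1+ε₀)^(−θ) ≤ a). [difficulty:
provable-now] -/
@[route_item "route-NavierStokesRegularity-TaoLadderRungTwo", crux]
def RestartGlue : Prop :=
  ∀ (ε₀ θ c : ℝ) (m : ℕ) (i₀ : Fin m) (n₀ : ℤ) (X₀ : Fin m → ℝ) (P Q : (Fin m → ℤ → ℝ) → (Fin m → ℤ → ℝ) → Prop) (N : ℤ) (X E : Fin m → ℤ → ℝ → ℝ) (t e : ℤ → ℝ) (τ₁ a : ℝ), 0 < ε₀ → n₀ ≤ N → Literature.Analysis.FluidPDE.TaoCascade.EpochCheckpoints ε₀ θ c i₀ n₀ X₀ P Q N X E t e → Literature.Analysis.FluidPDE.TaoCascade.StepTo ε₀ θ c i₀ P Q (Literature.Analysis.FluidPDE.TaoCascade.restartX ε₀ N (t N) (e N) X) (Literature.Analysis.FluidPDE.TaoCascade.restartE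 ε₀ N (t N) (e N) E) τ₁ a → Literature.Analysis.FluidPDE.TaoCascade.EpochCheckpoints ε₀ θ c i₀ n₀ X₀ P Q (N + 1) X E (Function.update t (N + 1) (t N + τ₁ / (e N * (1 + ε₀) ^ ((5 : ℝ) * N / 2)))) (Function.update e (N + 1) (a * e N))

-- `RestartGlue` holds: proved by `Summit.NavierStokesRegularity.NavierStokesRegularity.Theorems.taoLadderRungTwo_restartGlue_proof` (its module imports this route file, so no `_holds` link can be stated here).

/-- item stmt-NavierStokesRegularity-20426 · support · rank 9 · closed · proved by Summit.NavierStokesRegularity.NavierStokesRegularity.Theorems.taoLadderRungTwo_localDynamicsSufficesAt_proof (prover) · by planner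
sources: Tao2016AveragedNS, arXiv:1402.0290
[support] The local robust checkpoint induction implies the blow-up claim at one scale ratio (cell
v5 `localDynamicsSufficesAt`, over `TaoCascade.DynamicsLocalAt`): for ε₀ > 0 and R ≥ 1,
`DynamicsLocalAt ε₀ R` ⇒ ∃ α ∈ InTableClass R, X₀ with `NoGlobalCascade ε₀ α X₀` — take the table
and datum of DynamicsLocalAt; given K₁, K₂ and the N₀ of its (step) clause, for n₀ ≥ N₀ and a global
pseudo-solution restrict it to [0, T] with T = t_N + c(1+ε₀)^(−5N/2)/e_N (tree
`CascadeODESolutionFrom.restrict`) and run the ℤ-induction on the level N carrying ∃ t e,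
EpochCheckpoints … N (base: anchor t = 0, e = |X₀ i₀|, state = the rescaled datum by tree
`CascadeODESolutionOn.window_zero`, no epochs); forgetting Q (`EpochCheckpoints.toShellCheckpoints`)
this is «shell checkpoints at every level», which the TREE THEOREM
`TaoCascade.noGlobalCascade_of_forall_shellCheckpoints` (= `checkpointContradiction_holds`, p498221
— the cell's former support checkpointContradiction is CLOSED BY THE TREE) turns into
NoGlobalCascade for 0 ≤ θ < 5/2, c ≥ 0. [difficulty: M] -/
@[route_item "route-NavierStokesRegularity-TaoLadderRungTwo", crux]
def LocalDynamicsSufficesAt : Prop :=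
  ∀ ε₀ R : ℝ, 0 < ε₀ → 1 ≤ R → Literature.Analysis.FluidPDE.TaoCascade.DynamicsLocalAt ε₀ R → ∃ (α : Fin 4 → Fin 4 → Fin 4 → ℤ × ℤ × ℤ → ℝ) (X₀ : Fin 4 → ℝ), Literature.Analysis.FluidPDE.TaoCascade.InTableClass R α ∧ Literature.Analysis.FluidPDE.TaoCascade.NoGlobalCascade ε₀ α X₀

-- `LocalDynamicsSufficesAt` holds: proved by `Summit.NavierStokesRegularity.NavierStokesRegularity.Theorems.taoLadderRungTwo_localDynamicsSufficesAt_proof` (its module imports this route file, so no `_holds` link can be stated here).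

/-- item stmt-NavierStokesRegularity-20501 · assembly · rank 1 · closed · proved by Summit.NavierStokesRegularity.NavierStokesRegularity.Theorems.taoLadderRungTwo_assembly_proof (prover) · by planner
sources: Tao2016AveragedNS, arXiv:1402.0290
[assembly] ComparableGapCertificates → GappedFrontRobust → RestartControl → RestartGlue →
LocalDynamicsSufficesAt → Target (the rung leaf M_2-latt; NOT the summit `NavierStokesRegularity`,
which this route does not conclude — class rung, D-0061). -/
@[route_item "route-NavierStokesRegularity-TaoLadderRungTwo"]
def Assembly : Prop :=
  ComparableGapCertificates → GappedFrontRobust → RestartControl → RestartGlue → LocalDynamicsSufficesAt → Target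

-- `Assembly` holds: proved by `Summit.NavierStokesRegularity.NavierStokesRegularity.Theorems.taoLadderRungTwo_assembly_proof` (its module imports this route file, so no `_holds` link can be stated here).

attribute [summit_statement] _root_.Summit.NavierStokesRegularity.NavierStokesRegularity.Theses.TaoLadderRungTwo.Target

/-! D-0027 §2.1 — DECIDING THEOREM (planner-authored via `route open/edit --closes-file`; by planner-harvest-h2-tao-ladder-theory-1-g14-0 2026-08-27T21:09:20Z):
its hypotheses are this route's items and its conclusion the registered leaf `Summit.NavierStokesRegularity.NavierStokesRegularity.Theses.TaoLadderRungTwo.Target` (rung TL-M2, D-0061) (glue_lint), and it elaborates with this file. -/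

/-- DECIDING THEOREM of route `TaoLadderRungTwo`, CERTIFICATE FORMAT v2 (rung-leaf route, TAO-LADDER M₂
at the lattice level; MODEL lattice only — nothing about Navier–Stokes): the uniform certificate crux
K_A₂ (`ComparableGapCertificatesV2`: format-v2 gap data `GapData₂ σ …` with a thin tail, for comparable
tables at EVERY small scale ratio `ε₀ ≤ εs`, fixed spread `R`) and the perturbation crux K_B₂
(`GappedFrontRobustV2`: v2 gap data with a thin tail ⇒ a robust front step with margin) give a robust
front step at each `ε₀ ≤ εs`; `GapData₂.toGapData` feeds the v1 projections `GapData.signs` /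
`GapData.datum_mem_ball`; the restart supports (`RestartControl`, `RestartGlue`) turn the step into
`DynamicsLocalAt ε₀ R`; `LocalDynamicsSufficesAt` gives `NoGlobalCascade ε₀ α X₀`, i.e. `Target`.
The v1 items `ComparableGapCertificates` / `GappedFrontRobust` (K_B v1 UNPROVABLE-AS-TYPED, held
2026-08-27) are no longer hypotheses (retriaged `aside`). Same proof as the v1 `closes` (port of the
cell's kernel-checked chain `rungTwoLatt_of_gap`) with `hgap := hgap₂.toGapData`. -/
@[closes "route-NavierStokesRegularity-TaoLadderRungTwo"] theorem closes (h₁ : ComparableGapCertificatesV2) (h₂ : GappedFrontRobustV2) (h₃ : RestartControl)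
    (h₄ : RestartGlue) (h₅ : LocalDynamicsSufficesAt) : Target := by
  obtain ⟨R, hR, εs, hεs₀, hεs₁, hall⟩ := h₁
  refine ⟨R, hR, εs, hεs₀, hεs₁, fun ε₀ hε₀ hε₀s => ?_⟩
  obtain ⟨σ, i₀, α, X₀, Z, w, r, ρ, θ₀, θ, c₀, c, env₀, hα, hX₀, hgap₂, hthin⟩ := hall ε₀ hε₀ hε₀s
  obtain ⟨η, env, hη, -, hstep⟩ := h₂ R σ ε₀ i₀ α X₀ Z w r ρ θ₀ θ c₀ c env₀ hα hε₀ hgap₂ hthin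
  have hgap := Literature.Analysis.FluidPDE.TaoCascade.GapData₂.toGapData hgap₂
  obtain ⟨-, -, -, hθ₀, hθ₀θ, hθ, hc₀, hc₀c, -⟩ :=
    Literature.Analysis.FluidPDE.TaoCascade.GapData.signs hgap
  have hball := Literature.Analysis.FluidPDE.TaoCascade.GapData.datum_mem_ball hgap
    (Literature.Analysis.FluidPDE.TaoCascade.datumEnergy i₀ X₀)
  have hc : 0 < c := lt_trans hc₀ hc₀c
  have hdyn : Literature.Analysis.FluidPDE.TaoCascade.DynamicsLocalAt ε₀ R := by
    refine ⟨θ, c, i₀, α, X₀, Literature.Analysis.FluidPDE.TaoCascade.ballDesc Z w r,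
      Literature.Analysis.FluidPDE.TaoCascade.epochEnvelope env, by linarith, by linarith, hc,
      hα, hX₀, hball, ?_⟩
    intro K₁ K₂ hK₁ hK₂
    obtain ⟨N₀, hN₀⟩ := h₃ ε₀ θ c η i₀ α X₀
      (Literature.Analysis.FluidPDE.TaoCascade.ballDesc Z w r) env K₁ K₂ hε₀ hθ hc.le hη hX₀ hK₁ hK₂
    refine ⟨N₀, fun n₀ hn₀ T hT X E hsol N hN t e hcp hhor => ?_⟩
    have heN : 0 < e N := hcp.e_pos N hN le_rfl
    have hpow : 0 < (1 + ε₀) ^ ((5 : ℝ) * N / 2) := Real.rpow_pos_of_pos (by linarith) _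
    have hγ : 0 < e N * (1 + ε₀) ^ ((5 : ℝ) * N / 2) := mul_pos heN hpow
    have hneg : (1 + ε₀) ^ (-(5 : ℝ) * N / 2) = ((1 + ε₀) ^ ((5 : ℝ) * N / 2))⁻¹ := by
      rw [← Real.rpow_neg (by linarith : (0 : ℝ) ≤ 1 + ε₀)]
      congr 1
      ring
    have hcγ : c * (1 + ε₀) ^ (-(5 : ℝ) * N / 2) * (e N)⁻¹ =
        c / (e N * (1 + ε₀) ^ ((5 : ℝ) * N / 2)) := by
      rw [hneg]
      field_simp
    rw [hcγ] at hhor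
    have hdiv : 0 < c / (e N * (1 + ε₀) ^ ((5 : ℝ) * N / 2)) := div_pos hc hγ
    have htN : t N < T := by linarith
    have hτ : c ≤ (T - t N) * (e N * (1 + ε₀) ^ ((5 : ℝ) * N / 2)) := by
      have h2 : c / (e N * (1 + ε₀) ^ ((5 : ℝ) * N / 2)) ≤ T - t N := by linarith
      have h3 := mul_le_mul_of_nonneg_right h2 hγ.le
      rwa [div_mul_cancel₀ c hγ.ne'] at h3
    obtain ⟨hflow, hslack⟩ := hN₀ n₀ hn₀ T hT X E hsol N hN t e hcp htN
    obtain ⟨τ₁, a, hst⟩ :=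
      hstep (N - n₀).toNat _ _ _ (hcp.state N hN le_rfl) hslack _ hτ _ _ hflow
    exact ⟨_, _, h₄ ε₀ θ c 4 i₀ n₀ X₀ _ _ N X E t e τ₁ a hε₀ hN hcp hst⟩
  exact h₅ ε₀ R hε₀ hR hdyn

end Summit.NavierStokesRegularity.NavierStokesRegularity.Theses.TaoLadderRungTwo
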